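import Summits.ResolutionOfSingularities.ResolutionOfSingularities.Theorems.FrobeniusLadderFInjectiveMacaulayficationWeightedConeCore
import Summits.ResolutionOfSingularities.ResolutionOfSingularities.Theorems.FrobeniusLadderFInjectiveMacaulayficationCNChartClause
import Summits.ResolutionOfSingularities.ResolutionOfSingularities.Theorems.FrobeniusLadderFInjectiveMacaulayficationMonomialChartPresentationKernel
import Mathlib.RingTheory.MvPolynomial.WeightedHomogeneous
import Mathlib.LinearAlgebra.Matrix.Determinant.Basic
import HarnessLib

/-!
# G5ᴾ — THE CN ENGINE IN GLOBAL FORM `CNConeFiModel`, LANDED (plan-1's `L/w45a/CNEngineSig.lean` v4 e362faa4b2cb745d §1 + §3 VERBATIM)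
# (crux `FInjectiveMacaulayfication`, line `graded-engine` §18; CRUX-PLAN v7 ruling (R7.1): «stub-3 lands v4 §1+§3 as CNConeFiModel»)

Support file for crux stmt-ResolutionOfSingularities-15315 (`FrobeniusLadder.FInjectiveMacaulayfication`), chain w45a,
seat res-L1-w45a-stub-3. [OURS · L1 W4.5a] — NOT a statement of the manuscript; AI-written (statement and proof terms by
res-L1-w45a-plan-1, landed verbatim by stub-3), weaker than expert review.

THE MONOMIAL BLOW-UP ENGINE: the blow-up of ONE monomial ideal `I_A` on `R = k[X]/(f)`, covered by its vertex charts `x^{m_c}`,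
is an F-injective Macaulayfication of `Spec R` as soon as the decidable chart data (`V_c` unimodular, `a_c`, (hgen), (h≥), cover
witnesses, `θ_c f = y^{d_c} g_c`, (hunit), no `yᵢ ∣ g_c`, simultaneous minimisers) are supplied together with: `(f)` prime, `x̄ⱼ ≠ 0`,
the clause off the origin (hoff), and CARTIER–NEWTON NONDEGENERACY in Fedder form for the finitely many strictly positive row-subset
weights. Pieces (all landed): §1 core = E6‴ `BlowupFiModelOfCover` + `ReesCoverOfPowers` (inside `WeightedConeCore`'s imports);
(C1) stub-1's `MonomialChartPresentationKernel.exists_monomialChartPresentation` p493383; (G4ᴾ) `CNChartClause.cnChartClause` p494458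
(= C2 p490448 + C3a p492570 + Fedder at a maximal ideal). A specimen (first: Q6) instantiates `cnConeFiModel` with data.

* `mk_monomial_ne_zero`, `cnConeFiModel_of_chartClause` (G5ᴾ-core), `cnConeFiModel` (G5ᴾ).

No definitions, no named facts. [folklore]
-/

-- single-problem summit: the doubled namespace component is forced
set_option linter.dupNamespace false

noncomputable section

open AlgebraicGeometry CategoryTheory Literature.AlgebraicGeometry.Resolution MvPolynomial

namespace Summit.ResolutionOfSingularities.ResolutionOfSingularities.Theorems.FInjectiveMacaulayfication.CNConeFiModel

open Summit.ResolutionOfSingularities.ResolutionOfSingularities.Theorems.FInjectiveMacaulayfication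

/-! ## §1 G5ᴾ-core: the blow-up of a monomial ideal from chartwise certificates (PROVED) -/

/-- `x̄^b ≠ 0` in the domain `k[X]/(f)` when every `x̄ⱼ ≠ 0`. [folklore] -/
theorem mk_monomial_ne_zero {k : Type} [Field k] {n : ℕ} (f : MvPolynomial (Fin n) k)
    [(Ideal.span {f}).IsPrime]
    (hXne : ∀ v : Fin n, Ideal.Quotient.mk (Ideal.span {f}) (MvPolynomial.X v) ≠ 0) (b : Fin n →₀ ℕ) :
    Ideal.Quotient.mk (Ideal.span {f}) (monomial b (1 : k)) ≠ 0 := by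
  haveI : IsDomain (MvPolynomial (Fin n) k ⧸ Ideal.span {f}) := Ideal.Quotient.isDomain _
  rw [monomial_eq, C_1, one_mul, Finsupp.prod, map_prod]
  refine Finset.prod_ne_zero_iff.mpr fun j _ => ?_
  rw [map_pow]
  exact pow_ne_zero _ (hXne j)

/-- **G5ᴾ-core — THE MONOMIAL BLOW-UP ENGINE, CORE FORM.** `A` a finite set of non-zero exponents, `I_A` the
monomial ideal it generates, vertex exponents `m_c ∈ A` whose charts cover (`(x^a)^K = x^{m_c} · y`, `y ∈ I_A^{K-1}`),
`(f)` prime with all `x̄ⱼ ≠ 0`; if `R = k[X]/(f)` satisfies the clause at the maximal ideals off the origin and every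
affine blow-up algebra `R[I_A R/x̄^{m_c}]` satisfies the Cohen–Macaulay + Frobenius-closed clause at its maximal ideals
containing `x̄^{m_c}`, then `Spec R` admits the crux's model. Proof = `weightedConeFiModel_of_chartClause` with the
cover read off the identities instead of Veronese saturation; the centre `I_A R` is written `Ideal.span (x̄^a : a ∈ A)` (span of the
images, the form of the landed (C1)). [folklore] -/
theorem cnConeFiModel_of_chartClause (p : ℕ) [Fact p.Prime] (k : Type) [Field k] [CharP k p] (n : ℕ)
    (A : Finset (Fin n →₀ ℕ)) (hA0 : (0 : Fin n →₀ ℕ) ∉ A)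
    (t : ℕ) (ht : 0 < t) (m : Fin t → (Fin n →₀ ℕ)) (hm : ∀ c : Fin t, m c ∈ A)
    (hcov : ∀ a ∈ A, ∃ (c : Fin t) (K : ℕ), 1 ≤ K ∧ ∃ y ∈ (Ideal.span ((fun b : Fin n →₀ ℕ => (MvPolynomial.monomial b (1 : k) : MvPolynomial (Fin n) k)) '' (A : Set (Fin n →₀ ℕ)))) ^ (K - 1),
      (MvPolynomial.monomial a (1 : k) : MvPolynomial (Fin n) k) ^ K = MvPolynomial.monomial (m c) 1 * y)
    (f : MvPolynomial (Fin n) k) (hfprime : (Ideal.span {f}).IsPrime)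
    (hXne : ∀ v : Fin n, Ideal.Quotient.mk (Ideal.span {f}) (MvPolynomial.X v) ≠ 0)
    (hoff : ∀ (Q : Ideal (MvPolynomial (Fin n) k ⧸ Ideal.span {f})) [Q.IsMaximal],
      (∃ j : Fin n, Ideal.Quotient.mk (Ideal.span {f}) (MvPolynomial.X j) ∉ Q) →
      ∀ d : ℕ, ringKrullDim (Localization.AtPrime Q) = d → ∀ s : Fin d → Localization.AtPrime Q,
        (Ideal.span (Set.range s)).radical.IsMaximal →
          RingTheory.Sequence.IsWeaklyRegular (Localization.AtPrime Q) (List.ofFn s) ∧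
          ∀ y : Localization.AtPrime Q, (∃ e : ℕ, y ^ p ^ e ∈ Ideal.span
            ((fun z : Localization.AtPrime Q => z ^ p ^ e) ''
              (Ideal.span (Set.range s) : Set (Localization.AtPrime Q)))) → y ∈ Ideal.span (Set.range s))
    (hon : ∀ (c : Fin t) (Q : Ideal (blowupAlgebra (Ideal.span ((fun b : Fin n →₀ ℕ => Ideal.Quotient.mk (Ideal.span {f}) (MvPolynomial.monomial b (1 : k))) '' (A : Set (Fin n →₀ ℕ)))) (Ideal.Quotient.mk (Ideal.span {f}) (MvPolynomial.monomial (m c) 1)))) [Q.IsMaximal],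
      algebraMap (MvPolynomial (Fin n) k ⧸ Ideal.span {f}) (blowupAlgebra (Ideal.span ((fun b : Fin n →₀ ℕ => Ideal.Quotient.mk (Ideal.span {f}) (MvPolynomial.monomial b (1 : k))) '' (A : Set (Fin n →₀ ℕ)))) (Ideal.Quotient.mk (Ideal.span {f}) (MvPolynomial.monomial (m c) 1))) (Ideal.Quotient.mk (Ideal.span {f}) (MvPolynomial.monomial (m c) 1)) ∈ Q →
      ∀ d : ℕ, ringKrullDim (Localization.AtPrime Q) = d → ∀ s : Fin d → Localization.AtPrime Q,
        (Ideal.span (Set.range s)).radical.IsMaximal →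
          RingTheory.Sequence.IsWeaklyRegular (Localization.AtPrime Q) (List.ofFn s) ∧
          ∀ y : Localization.AtPrime Q, (∃ e : ℕ, y ^ p ^ e ∈ Ideal.span
            ((fun z : Localization.AtPrime Q => z ^ p ^ e) ''
              (Ideal.span (Set.range s) : Set (Localization.AtPrime Q)))) → y ∈ Ideal.span (Set.range s)) :
    ∃ (X' : Scheme.{0}) (π : X' ⟶ Spec (.of (MvPolynomial (Fin n) k ⧸ Ideal.span {f}))), IsProper π ∧
      Literature.AlgebraicGeometry.Resolution.IsBirational π ∧
      ∀ y : X', IsDomain (X'.presheaf.stalk y) ∧ ∀ d : ℕ, ringKrullDim (X'.presheaf.stalk y) = d →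
        ∀ s : Fin d → X'.presheaf.stalk y, (Ideal.span (Set.range s)).radical.IsMaximal →
          RingTheory.Sequence.IsWeaklyRegular (X'.presheaf.stalk y) (List.ofFn s) ∧
          ∀ z : X'.presheaf.stalk y, (∃ e : ℕ, z ^ p ^ e ∈
              Ideal.span ((fun w : X'.presheaf.stalk y => w ^ p ^ e) ''
                (Ideal.span (Set.range s) : Set (X'.presheaf.stalk y)))) →
            z ∈ Ideal.span (Set.range s) := by
  haveI := hfprime
  haveI : IsDomain (MvPolynomial (Fin n) k ⧸ Ideal.span {f}) := Ideal.Quotient.isDomain _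
  haveI : CharP (MvPolynomial (Fin n) k ⧸ Ideal.span {f}) p :=
    charP_of_injective_algebraMap (algebraMap k (MvPolynomial (Fin n) k ⧸ Ideal.span {f})).injective p
  -- names: the centre `I = I_A · R` and the covering sub-family `v c = x̄ ^ (m c)`
  obtain ⟨I, hI⟩ : ∃ I : Ideal (MvPolynomial (Fin n) k ⧸ Ideal.span {f}), I = Ideal.span ((fun b : Fin n →₀ ℕ => Ideal.Quotient.mk (Ideal.span {f}) (MvPolynomial.monomial b (1 : k))) '' (A : Set (Fin n →₀ ℕ))) := ⟨_, rfl⟩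
  -- the same ideal written as an extension (the v3 form, used by the cover and Jacobson steps)
  have hImap : I = (Ideal.span ((fun b : Fin n →₀ ℕ => (MvPolynomial.monomial b (1 : k) : MvPolynomial (Fin n) k)) '' (A : Set (Fin n →₀ ℕ)))).map (Ideal.Quotient.mk (Ideal.span {f})) := by
    rw [hI, Ideal.map_span, Set.image_image]
  obtain ⟨v, hv⟩ : ∃ v : Fin t → MvPolynomial (Fin n) k ⧸ Ideal.span {f},
      v = fun c => Ideal.Quotient.mk (Ideal.span {f}) (MvPolynomial.monomial (m c) 1) := ⟨_, rfl⟩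
  have hvI : ∀ c : Fin t, v c ∈ I := by
    intro c
    rw [hv, hI]
    exact Ideal.subset_span ⟨m c, hm c, rfl⟩
  have hv0 : ∀ c : Fin t, v c ≠ 0 := fun c => by
    rw [hv]
    exact mk_monomial_ne_zero f hXne (m c)
  have hI0 : I ≠ ⊥ := fun h => hv0 ⟨0, ht⟩ (by simpa [h] using hvI ⟨0, ht⟩)
  -- the centre lies in the ideal of the variables (`0 ∉ A`)
  have hIle : I ≤ Ideal.span (Set.range fun j : Fin n => Ideal.Quotient.mk (Ideal.span {f}) (MvPolynomial.X j)) := by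
    rw [hImap, show (Set.range fun j : Fin n => Ideal.Quotient.mk (Ideal.span {f}) (MvPolynomial.X j)) =
      Ideal.Quotient.mk (Ideal.span {f}) '' Set.range (fun j : Fin n => (X j : MvPolynomial (Fin n) k)) from
      by rw [← Set.range_comp]; rfl, ← Ideal.map_span]
    refine Ideal.map_mono ?_
    rw [Ideal.span_le]
    rintro _ ⟨b, hb, rfl⟩
    refine WeightedConeCore.monomial_mem_span_X_of_ne_zero b ?_
    rintro rfl
    exact hA0 hb
  -- THE COVER, read off the identities `(x^a)^K = x^(m c) · y`
  have hcov' : (HomogeneousIdeal.irrelevant (reesGrading I)).toIdeal ≤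
      (Ideal.span (Set.range fun c : Fin t => reesT (I := I) (v c) (hvI c))).radical := by
    refine ReesCoverOfPowers.stub_reesCoverOfPowers _ I (Ideal.Quotient.mk (Ideal.span {f}) '' ((fun b : Fin n →₀ ℕ => (MvPolynomial.monomial b (1 : k) : MvPolynomial (Fin n) k)) '' (A : Set (Fin n →₀ ℕ)))) (by rw [hImap, Ideal.map_span]) t v hvI ?_
    rintro _ ⟨_, ⟨a, ha, rfl⟩, rfl⟩
    obtain ⟨c, K, hK, y, hy, hEq⟩ := hcov a ha
    refine ⟨c, K, hK, Ideal.Quotient.mk (Ideal.span {f}) y, ?_, ?_⟩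
    · rw [hImap, ← Ideal.map_pow]
      exact Ideal.mem_map_of_mem _ hy
    · rw [hv]
      show _ = Ideal.Quotient.mk (Ideal.span {f}) (MvPolynomial.monomial (m c) 1) * _
      rw [← map_pow, hEq, map_mul]
  -- OFF THE CENTRE (Jacobson)
  have hoff' : ∀ (P : Ideal (MvPolynomial (Fin n) k ⧸ Ideal.span {f})) [P.IsPrime], ¬ I ≤ P →
      IsDomain (Localization.AtPrime P) ∧
      ∀ d : ℕ, ringKrullDim (Localization.AtPrime P) = d → ∀ s : Fin d → Localization.AtPrime P,
        (Ideal.span (Set.range s)).radical.IsMaximal →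
          RingTheory.Sequence.IsWeaklyRegular (Localization.AtPrime P) (List.ofFn s) ∧
          ∀ y : Localization.AtPrime P, (∃ e : ℕ, y ^ p ^ e ∈ Ideal.span
            ((fun z : Localization.AtPrime P => z ^ p ^ e) ''
              (Ideal.span (Set.range s) : Set (Localization.AtPrime P)))) → y ∈ Ideal.span (Set.range s) := by
    intro P _ hP
    obtain ⟨Q, hQ, hPQ, j, hj⟩ := WeightedConeCore.exists_maximal_not_mem_X f I hIle P hP
    haveI := hQ
    exact ClauseOfMaximal.fiClause_atPrime_of_le p hPQ ⟨inferInstance, hoff Q ⟨j, hj⟩⟩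
  -- ON THE EXCEPTIONAL LOCUS, chart by chart
  have hon' : ∀ (c : Fin t) (Q : Ideal (blowupAlgebra I (v c))) [Q.IsMaximal],
      algebraMap (MvPolynomial (Fin n) k ⧸ Ideal.span {f}) (blowupAlgebra I (v c)) (v c) ∈ Q →
      ∀ d : ℕ, ringKrullDim (Localization.AtPrime Q) = d → ∀ s : Fin d → Localization.AtPrime Q,
        (Ideal.span (Set.range s)).radical.IsMaximal →
          RingTheory.Sequence.IsWeaklyRegular (Localization.AtPrime Q) (List.ofFn s) ∧
          ∀ y : Localization.AtPrime Q, (∃ e : ℕ, y ^ p ^ e ∈ Ideal.span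
            ((fun z : Localization.AtPrime Q => z ^ p ^ e) ''
              (Ideal.span (Set.range s) : Set (Localization.AtPrime Q)))) → y ∈ Ideal.span (Set.range s) := by
    subst hI hv
    intro c Q _ hQ
    exact hon c Q hQ
  exact BlowupFiModelOfCover.stub_blowupFiModelOfCover p (MvPolynomial (Fin n) k ⧸ Ideal.span {f}) I t v
    hvI hI0 hv0 hcov' hoff' hon'


/-! ## §3 G5ᴾ — the global statement, an unconditional theorem -/

set_option maxHeartbeats 800000 in
/-- **G5ᴾ `cnConeFiModel` — THE CN ENGINE, GLOBAL FORM: A THEOREM** (every piece landed; the conclusion is the statement a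
specimen instantiates; all side conditions on `A, V_c, m_c, a_c, d_c, g_c` are decidable identities on explicit data).
Per chart: the landed (C1) presentation `e : k[y]/(g_c) → R[I_A R/x̄^(m_c)]` (bijective; upgraded by `RingEquiv.ofBijective`)
pulls a maximal `Q ∋ x̄^(m_c)/1` back to a maximal `Q'` containing every `θ(X_j)` (because `x̄ⱼ^ε/x̄^(m_c) ∈ R[I_A R/x̄^(m_c)]`
by (prim), so `(x̄ⱼ/1)^ε ∈ Q`), `(g_c)` is prime because the chart is a subring of the domain `R[1/x̄^(m_c)]`, `g_c ≠ 0`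
because no `yᵢ` divides it, the clause at `Q'` is (G4ᴾ) `CNChartClause.cnChartClause`, and it transports along
`k[y]/(g_c)_(Q') ≅ R[I_A R/x̄^(m_c)]_Q`; then §1. [folklore] -/
theorem cnConeFiModel :
    ∀ (p : ℕ) [Fact p.Prime] (k : Type) [Field k] [CharP k p] (n : ℕ), 0 < n →
    ∀ (A : Finset (Fin n →₀ ℕ)), (0 : Fin n →₀ ℕ) ∉ A →
    (∀ j : Fin n, ∃ e : ℕ, 0 < e ∧ Finsupp.single j e ∈ A) →
    ∀ (t : ℕ), 0 < t → ∀ (V : Fin t → Matrix (Fin n) (Fin n) ℕ), (∀ c, IsUnit ((V c).map (Nat.cast : ℕ → ℤ)).det) →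
    ∀ (m : Fin t → (Fin n →₀ ℕ)), (∀ c, m c ∈ A) →
    ∀ (a : Fin t → Fin n → (Fin n →₀ ℕ)), (∀ c i, a c i ∈ A) →
    (∀ (c : Fin t) (i : Fin n), (Finsupp.equivFunOnFinite.symm ((V c).mulVec ⇑(a c i)) : Fin n →₀ ℕ) =
      Finsupp.equivFunOnFinite.symm ((V c).mulVec ⇑(m c)) + Finsupp.single i 1) →
    (∀ (c : Fin t), ∀ e ∈ A, (Finsupp.equivFunOnFinite.symm ((V c).mulVec ⇑(m c)) : Fin n →₀ ℕ) ≤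
      Finsupp.equivFunOnFinite.symm ((V c).mulVec ⇑e)) →
    (∀ e ∈ A, ∃ (c : Fin t) (K : ℕ), 1 ≤ K ∧ ∃ y ∈ (Ideal.span ((fun b : Fin n →₀ ℕ => (MvPolynomial.monomial b (1 : k) : MvPolynomial (Fin n) k)) '' (A : Set (Fin n →₀ ℕ)))) ^ (K - 1),
      (MvPolynomial.monomial e (1 : k) : MvPolynomial (Fin n) k) ^ K = MvPolynomial.monomial (m c) 1 * y) →
    ∀ (f : MvPolynomial (Fin n) k), (Ideal.span {f}).IsPrime →
    (∀ v : Fin n, Ideal.Quotient.mk (Ideal.span {f}) (MvPolynomial.X v) ≠ 0) →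
    (∀ (Q : Ideal (MvPolynomial (Fin n) k ⧸ Ideal.span {f})) [Q.IsMaximal],
      (∃ j : Fin n, Ideal.Quotient.mk (Ideal.span {f}) (MvPolynomial.X j) ∉ Q) →
      ∀ d : ℕ, ringKrullDim (Localization.AtPrime Q) = d → ∀ s : Fin d → Localization.AtPrime Q,
        (Ideal.span (Set.range s)).radical.IsMaximal →
          RingTheory.Sequence.IsWeaklyRegular (Localization.AtPrime Q) (List.ofFn s) ∧
          ∀ y : Localization.AtPrime Q, (∃ e : ℕ, y ^ p ^ e ∈ Ideal.span
            ((fun z : Localization.AtPrime Q => z ^ p ^ e) ''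
              (Ideal.span (Set.range s) : Set (Localization.AtPrime Q)))) → y ∈ Ideal.span (Set.range s)) →
    (∀ (c : Fin t) (S : Finset (Fin n)), (∀ j : Fin n, 0 < ∑ i ∈ S, V c i j) →
      (∀ D : ℕ, (MvPolynomial.weightedHomogeneousComponent (fun j : Fin n => ∑ i ∈ S, V c i j) D f ≠ 0 ∧
          ∀ D' < D, MvPolynomial.weightedHomogeneousComponent (fun j : Fin n => ∑ i ∈ S, V c i j) D' f = 0) →
        ∀ (K : Type) [Field K] [Algebra k K] (b : Fin n → K), (∀ i, b i ≠ 0) →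
          MvPolynomial.aeval b (MvPolynomial.weightedHomogeneousComponent (fun j : Fin n => ∑ i ∈ S, V c i j) D f) = 0 →
          (MvPolynomial.map (algebraMap k K) (MvPolynomial.weightedHomogeneousComponent (fun j : Fin n => ∑ i ∈ S, V c i j) D f)) ^ (p - 1) ∉
            Ideal.span (Set.range fun i : Fin n => (MvPolynomial.X i - MvPolynomial.C (b i)) ^ p))) →
    ∀ (dv : Fin t → (Fin n →₀ ℕ)) (g : Fin t → MvPolynomial (Fin n) k),
    (∀ c, MvPolynomial.aeval (fun j : Fin n => ∏ i : Fin n, (MvPolynomial.X i : MvPolynomial (Fin n) k) ^ V c i j) f = MvPolynomial.monomial (dv c) 1 * g c) →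
    (∀ c, ∃ (N : ℕ) (r : Fin n →₀ ℕ), N • m c = ∑ i : Fin n, dv c i • a c i + r) →
    (∀ c, ∀ i : Fin n, ¬ (MvPolynomial.X i ∣ g c)) →
    (∀ c, ∃ m ∈ f.support, ∀ i : Fin n, ∑ j : Fin n, V c i j * m j = dv c i) →
    ∃ (X' : Scheme.{0}) (π : X' ⟶ Spec (.of (MvPolynomial (Fin n) k ⧸ Ideal.span {f}))), IsProper π ∧
      Literature.AlgebraicGeometry.Resolution.IsBirational π ∧
      ∀ y : X', IsDomain (X'.presheaf.stalk y) ∧ ∀ d : ℕ, ringKrullDim (X'.presheaf.stalk y) = d →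
        ∀ s : Fin d → X'.presheaf.stalk y, (Ideal.span (Set.range s)).radical.IsMaximal →
          RingTheory.Sequence.IsWeaklyRegular (X'.presheaf.stalk y) (List.ofFn s) ∧
          ∀ z : X'.presheaf.stalk y, (∃ e : ℕ, z ^ p ^ e ∈
              Ideal.span ((fun w : X'.presheaf.stalk y => w ^ p ^ e) ''
                (Ideal.span (Set.range s) : Set (X'.presheaf.stalk y)))) →
            z ∈ Ideal.span (Set.range s) := by
  intro p _ k _ _ n hn A hA0 hprim t ht V hV m hm a haA hgen hge hcov f hfprime hXne hoff hCN dv g hg hunit hndiv hface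
  refine cnConeFiModel_of_chartClause p k n A hA0 t ht m hm hcov f hfprime hXne hoff ?_
  intro c Q _ hQ
  haveI := hfprime
  haveI : IsDomain (MvPolynomial (Fin n) k ⧸ Ideal.span {f}) := Ideal.Quotient.isDomain _
  have hg0 : g c ≠ 0 := fun h0 => hndiv c ⟨0, hn⟩ (h0 ▸ dvd_zero _)
  -- the presentation of chart `c` (C1, landed), upgraded to a ring equivalence
  obtain ⟨e₀, hbij, -, heθ⟩ := MonomialChartPresentationKernel.exists_monomialChartPresentation f (V c) (hV c) (m c) (a c)
    (hgen c) A (haA c) (hge c) (dv c) (g c) (hg c) (hunit c) (hndiv c)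
  obtain ⟨e, he⟩ : ∃ e : (MvPolynomial (Fin n) k ⧸ Ideal.span {g c}) ≃+* ↥(blowupAlgebra (Ideal.span ((fun b : Fin n →₀ ℕ => Ideal.Quotient.mk (Ideal.span {f}) (MvPolynomial.monomial b (1 : k))) '' (A : Set (Fin n →₀ ℕ)))) (Ideal.Quotient.mk (Ideal.span {f}) (MvPolynomial.monomial (m c) 1))),
      ∀ x, e x = e₀ x := ⟨RingEquiv.ofBijective e₀ hbij, fun x => rfl⟩
  -- `(g c)` is prime: `k[y]/(g c)` is isomorphic to a subring of the domain `R[1/x̄^(m c)]`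
  haveI : IsDomain (Localization.Away (Ideal.Quotient.mk (Ideal.span {f}) (MvPolynomial.monomial (m c) (1 : k)))) :=
    IsLocalization.isDomain_localization
      (powers_le_nonZeroDivisors_of_noZeroDivisors (mk_monomial_ne_zero f hXne (m c)))
  haveI : IsDomain (MvPolynomial (Fin n) k ⧸ Ideal.span {g c}) := e.toMulEquiv.isDomain
  haveI hgp : (Ideal.span {g c}).IsPrime := (Ideal.Quotient.isDomain_iff_prime _).mp inferInstance
  -- `Q' = e⁻¹ Q` is maximal
  haveI hQ' : (Q.comap e.toRingHom).IsMaximal := Ideal.comap_isMaximal_of_equiv e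
  -- every `θ(X_j)` lies in `Q'`: `(x̄ⱼ/1)^ε = (x̄ⱼ^ε/x̄^m) · (x̄^m/1) ∈ Q`
  have hXQ : ∀ j : Fin n,
      Ideal.Quotient.mk (Ideal.span {g c}) (∏ i : Fin n, MvPolynomial.X i ^ V c i j) ∈ Q.comap e.toRingHom := by
    intro j
    obtain ⟨ε, hε, hεA⟩ := hprim j
    have hz : algebraMap (MvPolynomial (Fin n) k ⧸ Ideal.span {f}) (Localization.Away (Ideal.Quotient.mk (Ideal.span {f}) (MvPolynomial.monomial (m c) (1 : k))))
        (Ideal.Quotient.mk (Ideal.span {f}) (MvPolynomial.X j ^ ε)) * IsLocalization.Away.invSelf (Ideal.Quotient.mk (Ideal.span {f}) (MvPolynomial.monomial (m c) (1 : k))) ∈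
        blowupAlgebra (Ideal.span ((fun b : Fin n →₀ ℕ => Ideal.Quotient.mk (Ideal.span {f}) (MvPolynomial.monomial b (1 : k))) '' (A : Set (Fin n →₀ ℕ)))) (Ideal.Quotient.mk (Ideal.span {f}) (MvPolynomial.monomial (m c) 1)) := by
      refine div_mem_blowupAlgebra _ _ (Ideal.subset_span ⟨Finsupp.single j ε, hεA, ?_⟩)
      show Ideal.Quotient.mk (Ideal.span {f}) (MvPolynomial.monomial (Finsupp.single j ε) (1 : k)) = _
      rw [X_pow_eq_monomial]
    have hprod : (⟨_, hz⟩ : ↥(blowupAlgebra (Ideal.span ((fun b : Fin n →₀ ℕ => Ideal.Quotient.mk (Ideal.span {f}) (MvPolynomial.monomial b (1 : k))) '' (A : Set (Fin n →₀ ℕ)))) (Ideal.Quotient.mk (Ideal.span {f}) (MvPolynomial.monomial (m c) 1)))) *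
        algebraMap (MvPolynomial (Fin n) k ⧸ Ideal.span {f}) _ (Ideal.Quotient.mk (Ideal.span {f}) (MvPolynomial.monomial (m c) 1)) =
        (algebraMap (MvPolynomial (Fin n) k ⧸ Ideal.span {f}) _ (Ideal.Quotient.mk (Ideal.span {f}) (MvPolynomial.X j))) ^ ε := by
      apply Subtype.ext
      simp only [Subalgebra.coe_mul, Subalgebra.coe_algebraMap, SubmonoidClass.coe_pow]
      rw [← map_pow, ← map_pow]
      exact div_mul_algebraMap _ _
    have hmem : (algebraMap (MvPolynomial (Fin n) k ⧸ Ideal.span {f}) ↥(blowupAlgebra (Ideal.span ((fun b : Fin n →₀ ℕ => Ideal.Quotient.mk (Ideal.span {f}) (MvPolynomial.monomial b (1 : k))) '' (A : Set (Fin n →₀ ℕ)))) (Ideal.Quotient.mk (Ideal.span {f}) (MvPolynomial.monomial (m c) 1))) (Ideal.Quotient.mk (Ideal.span {f}) (MvPolynomial.X j))) ^ ε ∈ Q := by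
      rw [← hprod]
      exact Q.mul_mem_left _ hQ
    have hXjQ := (inferInstance : Q.IsPrime).mem_of_pow_mem _ hmem
    rw [Ideal.mem_comap]
    have hej : e.toRingHom (Ideal.Quotient.mk (Ideal.span {g c}) (∏ i : Fin n, MvPolynomial.X i ^ V c i j)) =
        algebraMap (MvPolynomial (Fin n) k ⧸ Ideal.span {f}) ↥(blowupAlgebra (Ideal.span ((fun b : Fin n →₀ ℕ => Ideal.Quotient.mk (Ideal.span {f}) (MvPolynomial.monomial b (1 : k))) '' (A : Set (Fin n →₀ ℕ)))) (Ideal.Quotient.mk (Ideal.span {f}) (MvPolynomial.monomial (m c) 1))) (Ideal.Quotient.mk (Ideal.span {f}) (MvPolynomial.X j)) := by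
      apply Subtype.ext
      rw [Subalgebra.coe_algebraMap]
      have h1 := heθ (MvPolynomial.X j)
      rw [MvPolynomial.aeval_X] at h1
      rw [RingEquiv.toRingHom_eq_coe, RingHom.coe_coe, he]
      exact h1
    rw [hej]
    exact hXjQ
  -- the clause at `Q'` (G4ᴾ, landed), transported along `k[y]/(g c)_(Q') ≅ (chart)_Q`
  have hcl := CNChartClause.cnChartClause p k n hn f (V c) (hV c) (dv c) (g c) hgp (hg c) hg0
    (fun S hS => hCN c S hS) (hface c) (Q.comap e.toRingHom) hXQ
  obtain ⟨eL⟩ := BlowupFiModelOfCover.nonempty_ringEquiv_localization_of_ringEquiv e (Q.comap e.toRingHom) Q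
    (fun x => Iff.rfl)
  exact DegreeZeroDescent.inlineClause_of_ringEquiv p eL hcl


end Summit.ResolutionOfSingularities.ResolutionOfSingularities.Theorems.FInjectiveMacaulayfication.CNConeFiModel

end
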